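import Summits.BirchSwinnertonDyer.BirchSwinnertonDyer.Theorems.AlignedTransportAtTwoMainConjectureOfRankZeroBSDAtTwoCubicLayerTwoOrderFourDoor
import Literature.NumberTheory.IwasawaTheory.ClassGroupLayerThreeOrderFourOfTowerCertificate
import HarnessLib

/-!
# Route `AlignedTransportAtTwo`, crux C2 `MainConjectureOfRankZeroBSDAtTwo` (stmt-BirchSwinnertonDyer-22298):
# THE LAYER-THREE ORDER-FOUR DOOR — a class of ORDER `4` in `Cl(K_3)`, `K_3 = ℚ(β)·ℚ(ζ₃₂)⁺` (degree 24), for the cubic `2`-torsion field of a curve with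
# `Δ_W < 0` and irreducible `W[2]`, from a THREE-STEP TOWER ORDER-FOUR CERTIFICATE written in `𝓞_{ℚ(β)}` (eight coordinates); hence `μ₂ = 0`, `λ₂ ≤ 6`
# via att-p3 g47's elementary-layer door at `k = 3`

HONEST FRAMING (cell `bsd-f1-sign2`, WIDTH-5 attached prover seat `bsd-line-att-p4` gen 41 on line `birth` of the lead `bsd-line-att-p2`;
`--supports` stmt-BirchSwinnertonDyer-22298, closes nothing; BSD is NOT proved by any of this; the crux C2, its verdict «blocked-on
`Rank1Residual.GreenbergMuConjectureIrreducible`» and every registered stub are untouched).  THEOREMS ONLY — no definition, no named fact, no `sorry`.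

WHY / WHAT.  The HARD CORE of the u7 sub-cell after this gen: `3027` settled (this seat's layer-TWO certificate, `…CubicLayerTwoOrderFourRowN3027`), `9139` (att-p3 g45),
leaving `1259, 3523, 14891` where `Cl(K_2)[2^∞] ≅ (ℤ/2)³` — att-p3 g47's door is silent at `k = 2` and fires at `k = 3` iff `Cl(K_3)` has a class of order `4`
(i.e. iff `μ₂ = 0` is already visible at layer 3: the Iwasawa module needs `≤ 6` generators).  This door is the W-level form of this seat's Literature theorems
`NumberFields.exists_orderOf_eq_four_of_tower3OrderFourCert` / `IwasawaTheory.exists_orderOf_eq_four_layer_three_of_tower3Cert`: every datum is an identity in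
`𝓞_{ℚ(β)} = ℤ[θ]` between coordinates on `1, s₁, s₂, s₁s₂, s₃, s₁s₃, s₂s₃, s₁s₂s₃` (`rank E_{K_3} = 15` units for a complex cubic, so `n ≥ 15`); the `2¹⁷ − 1` residue
certificates are supplied by `NumberFields.tower3Cert_of_charMatrix` from `17` characters.  NO CUSTOMER YET: the degree-`24` data (`15` units of `K_3`, an ideal
`(q₀, s₃ − t)` of order `4` with a generator of its fourth power, Bézout and ideal witnesses, `17` residue characters at primes `q ≡ ±1 (mod 32)`) is a data-seat
computation (`bnfinit`-size, root discriminant ≈ 215; GRH-free once re-verified here) — see this seat's memo and `HOME/L2CERT-att-p4-g41-data/L3-DATA-ASK.md`.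

Nothing is asserted about any seed, `μ₂` or `MC₂` here; nothing is closed; BSD is not proved.

References: [NeukirchANT1999] Ch. I §2, §3, §7 Thm. (7.4), §8; [Cohen1993] §6.5; [Washington1997] §13.1, §13.3; [Serre1973CourseArithmetic] Ch. I §3;
[SilvermanAEC2009] III.§1; tree: this seat's `…SqrtTwoTowerThreeOrderFourClassCertificate`, `…ClassGroupLayerThreeOrderFourOfTowerCertificate`, layer-two door.
-/

set_option linter.dupNamespace false
set_option autoImplicit false

noncomputable section

open scoped Classical NumberField nonZeroDivisors

namespace Summit.BirchSwinnertonDyer.BirchSwinnertonDyer.Theorems.AlignedTransportAtTwoCubicLayerThreeOrderFourDoor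

open NumberField IsDedekindDomain Polynomial WeierstrassCurve IntermediateField CongruenceSubgroup
  Literature.NumberTheory.IwasawaTheory Literature.NumberTheory.GaloisRepresentations
  Literature.NumberTheory.EllipticCurves Literature.NumberTheory.EllipticCurves.Greenberg1999
  Literature.NumberTheory.EllipticCurves.ModularForms
  Literature.NumberTheory.EllipticCurves.Rank1Residual
  Literature.NumberTheory.EllipticCurves.Module
  Literature.NumberTheory.NumberFields
  Summit.BirchSwinnertonDyer.Rank1Residual
  Summit.BirchSwinnertonDyer.Rank1Residual.X1.MuLambda
  Summit.BirchSwinnertonDyer.Rank1Residual.X5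
  Summit.BirchSwinnertonDyer.Rank1Residual.F1Sign2
  Summit.BirchSwinnertonDyer.BirchSwinnertonDyer.Theorems.Rank1ResidualX1Defs
  Summit.BirchSwinnertonDyer.BirchSwinnertonDyer.Theses.AlignedTransportAtTwo
  Summit.BirchSwinnertonDyer.BirchSwinnertonDyer.Theorems.AlignedTransportAtTwoCubicCarrierRoad
  Summit.BirchSwinnertonDyer.BirchSwinnertonDyer.Theorems.AlignedTransportAtTwoCubicLayerOneDoors

variable (W : WeierstrassCurve ℚ) [W.IsElliptic]

/-- **A CLASS OF ORDER `4` IN `Cl(K_3)` FOR THE CUBIC `2`-TORSION FIELD FROM A THREE-STEP TOWER ORDER-FOUR CERTIFICATE.**  `W/ℚ` elliptic with no rational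
`2`-torsion abscissa and `Δ_W < 0` (two infinite places, so `rank E_{K_3} = 15`), `β ∈ ℚ̄` a root of the `2`-division cubic, `2 ∤ d_{ℚ(β)}`, `n ≥ 15` units; DATA in
`𝓞_{ℚ(β)}` on eight coordinates exactly as in `IwasawaTheory.exists_orderOf_eq_four_layer_three_of_tower3Cert`.  THEN for every cyclotomic `ℤ₂`-extension `κ` of `ℚ(β)`
the class group of the THIRD layer has an element of ORDER `4` (the class of `(q₀, v)`).
[cite: NeukirchANT1999, Ch. I §7 Thm. (7.4), Ch. I §3, Ch. I §8] [cite: Cohen1993, §6.5] [cite: Washington1997, §13.1] -/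
theorem exists_orderOf_eq_four_layer_three_adjoin_of_tower3Cert (ht : ∀ x : ℚ, ¬ HasRationalTwoTorsionX W x) (hΔ : W.Δ < 0)
    {β : AlgebraicClosure ℚ} (hβ : aeval β W.twoTorsionPolynomial.toPoly = 0)
    (hd : haveI : FiniteDimensional ℚ ↥(IntermediateField.adjoin ℚ ({β} : Set (AlgebraicClosure ℚ))) :=
        IntermediateField.adjoin.finiteDimensional ((AlgebraicClosure.isAlgebraic ℚ).isAlgebraic β).isIntegral
      haveI : NumberField ↥(IntermediateField.adjoin ℚ ({β} : Set (AlgebraicClosure ℚ))) := NumberField.mk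
      ¬ (2 : ℤ) ∣ NumberField.discr ↥(IntermediateField.adjoin ℚ ({β} : Set (AlgebraicClosure ℚ))))
    {n : ℕ} (hn : 15 ≤ n)
    (a₀ a₁ a₂ a₃ a₄ a₅ a₆ a₇ c₀ c₁ c₂ c₃ c₄ c₅ c₆ c₇ : Fin n → 𝓞 ↥(IntermediateField.adjoin ℚ ({β} : Set (AlgebraicClosure ℚ))))
    {A₀ A₁ A₂ A₃ A₄ A₅ A₆ A₇ W₀ W₁ W₂ W₃ W₄ W₅ W₆ W₇ μ₀ μ₁ μ₂ μ₃ μ₄ μ₅ μ₆ μ₇ ν₀ ν₁ ν₂ ν₃ ν₄ ν₅ ν₆ ν₇ q₀ v₀ v₁ v₂ v₃ v₄ v₅ v₆ v₇ α₀ α₁ α₂ α₃ α₄ α₅ α₆ α₇ β₀ β₁ β₂ β₃ β₄ β₅ β₆ β₇ γ₀ γ₁ γ₂ γ₃ γ₄ γ₅ γ₆ γ₇ δ₀ δ₁ δ₂ δ₃ δ₄ δ₅ δ₆ δ₇ m₀ m₁ m₂ m₃ m₄ m₅ m₆ m₇ n₀ n₁ n₂ n₃ n₄ n₅ n₆ n₇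 l₀ l₁ l₂ l₃ l₄ l₅ l₆ l₇ V₀ V₁ V₂ V₃ V₄ V₅ V₆ V₇ : 𝓞 ↥(IntermediateField.adjoin ℚ ({β} : Set (AlgebraicClosure ℚ)))}
    (hu : ∀ i, a₀ i * c₀ i + 2 * a₁ i * c₁ i + 2 * a₂ i * c₂ i + 2 * a₂ i * c₃ i + 2 * a₃ i * c₂ i + 4 * a₃ i * c₃ i + 2 * a₄ i * c₄ i + 2 * a₄ i * c₆ i + 2 * a₄ i * c₇ i + 4 * a₅ i * c₅ i + 2 * a₅ i * c₆ i + 4 * a₅ i * c₇ i + 2 * a₆ i * c₄ i + 2 * a₆ i * c₅ i + 4 * a₆ i * c₆ i + 4 * a₆ i * c₇ i + 2 * a₇ i * c₄ i + 4 * a₇ i * c₅ i + 4 * a₇ i * c₆ i + 8 * a₇ i * c₇ i = 1 ∧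
      a₀ i * c₁ i + a₁ i * c₀ i + a₂ i * c₂ i + 2 * a₂ i * c₃ i + 2 * a₃ i * c₂ i + 2 * a₃ i * c₃ i + 2 * a₄ i * c₅ i + a₄ i * c₆ i + 2 * a₄ i * c₇ i + 2 * a₅ i * c₄ i + 2 * a₅ i * c₆ i + 2 * a₅ i * c₇ i + a₆ i * c₄ i + 2 * a₆ i * c₅ i + 2 * a₆ i * c₆ i + 4 * a₆ i * c₇ i + 2 * a₇ i * c₄ i + 2 * a₇ i * c₅ i + 4 * a₇ i * c₆ i + 4 * a₇ i * c₇ i = 0 ∧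
      a₀ i * c₂ i + 2 * a₁ i * c₃ i + a₂ i * c₀ i + 2 * a₃ i * c₁ i + a₄ i * c₄ i + 2 * a₄ i * c₆ i + 2 * a₅ i * c₅ i + 4 * a₅ i * c₇ i + 2 * a₆ i * c₄ i + 2 * a₆ i * c₆ i + 2 * a₆ i * c₇ i + 4 * a₇ i * c₅ i + 2 * a₇ i * c₆ i + 4 * a₇ i * c₇ i = 0 ∧
      a₀ i * c₃ i + a₁ i * c₂ i + a₂ i * c₁ i + a₃ i * c₀ i + a₄ i * c₅ i + 2 * a₄ i * c₇ i + a₅ i * c₄ i + 2 * a₅ i * c₆ i + 2 * a₆ i * c₅ i + a₆ i * c₆ i + 2 * a₆ i * c₇ i + 2 * a₇ i * c₄ i + 2 * a₇ i * c₆ i + 2 * a₇ i * c₇ i = 0 ∧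
      a₀ i * c₄ i + 2 * a₁ i * c₅ i + 2 * a₂ i * c₆ i + 2 * a₂ i * c₇ i + 2 * a₃ i * c₆ i + 4 * a₃ i * c₇ i + a₄ i * c₀ i + 2 * a₅ i * c₁ i + 2 * a₆ i * c₂ i + 2 * a₆ i * c₃ i + 2 * a₇ i * c₂ i + 4 * a₇ i * c₃ i = 0 ∧
      a₀ i * c₅ i + a₁ i * c₄ i + a₂ i * c₆ i + 2 * a₂ i * c₇ i + 2 * a₃ i * c₆ i + 2 * a₃ i * c₇ i + a₄ i * c₁ i + a₅ i * c₀ i + a₆ i * c₂ i + 2 * a₆ i * c₃ i + 2 * a₇ i * c₂ i + 2 * a₇ i * c₃ i = 0 ∧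
      a₀ i * c₆ i + 2 * a₁ i * c₇ i + a₂ i * c₄ i + 2 * a₃ i * c₅ i + a₄ i * c₂ i + 2 * a₅ i * c₃ i + a₆ i * c₀ i + 2 * a₇ i * c₁ i = 0 ∧
      a₀ i * c₇ i + a₁ i * c₆ i + a₂ i * c₅ i + a₃ i * c₄ i + a₄ i * c₃ i + a₅ i * c₂ i + a₆ i * c₁ i + a₇ i * c₀ i = 0)
    (hws : q₀ ^ 4 = A₀ * W₀ + 2 * A₁ * W₁ + 2 * A₂ * W₂ + 2 * A₂ * W₃ + 2 * A₃ * W₂ + 4 * A₃ * W₃ + 2 * A₄ * W₄ + 2 * A₄ * W₆ + 2 * A₄ * W₇ + 4 * A₅ * W₅ + 2 * A₅ * W₆ + 4 * A₅ * W₇ + 2 * A₆ * W₄ + 2 * A₆ * W₅ + 4 * A₆ * W₆ + 4 * A₆ * W₇ + 2 * A₇ * W₄ + 4 * A₇ * W₅ + 4 * A₇ * W₆ + 8 * A₇ * W₇ ∧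
      (0 : 𝓞 ↥(IntermediateField.adjoin ℚ ({β} : Set (AlgebraicClosure ℚ)))) = A₀ * W₁ + A₁ * W₀ + A₂ * W₂ + 2 * A₂ * W₃ + 2 * A₃ * W₂ + 2 * A₃ * W₃ + 2 * A₄ * W₅ + A₄ * W₆ + 2 * A₄ * W₇ + 2 * A₅ * W₄ + 2 * A₅ * W₆ + 2 * A₅ * W₇ + A₆ * W₄ + 2 * A₆ * W₅ + 2 * A₆ * W₆ + 4 * A₆ * W₇ + 2 * A₇ * W₄ + 2 * A₇ * W₅ + 4 * A₇ * W₆ + 4 * A₇ * W₇ ∧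
      (0 : 𝓞 ↥(IntermediateField.adjoin ℚ ({β} : Set (AlgebraicClosure ℚ)))) = A₀ * W₂ + 2 * A₁ * W₃ + A₂ * W₀ + 2 * A₃ * W₁ + A₄ * W₄ + 2 * A₄ * W₆ + 2 * A₅ * W₅ + 4 * A₅ * W₇ + 2 * A₆ * W₄ + 2 * A₆ * W₆ + 2 * A₆ * W₇ + 4 * A₇ * W₅ + 2 * A₇ * W₆ + 4 * A₇ * W₇ ∧
      (0 : 𝓞 ↥(IntermediateField.adjoin ℚ ({β} : Set (AlgebraicClosure ℚ)))) = A₀ * W₃ + A₁ * W₂ + A₂ * W₁ + A₃ * W₀ + A₄ * W₅ + 2 * A₄ * W₇ + A₅ * W₄ + 2 * A₅ * W₆ + 2 * A₆ * W₅ + A₆ * W₆ + 2 * A₆ * W₇ + 2 * A₇ * W₄ + 2 * A₇ * W₆ + 2 * A₇ * W₇ ∧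
      (0 : 𝓞 ↥(IntermediateField.adjoin ℚ ({β} : Set (AlgebraicClosure ℚ)))) = A₀ * W₄ + 2 * A₁ * W₅ + 2 * A₂ * W₆ + 2 * A₂ * W₇ + 2 * A₃ * W₆ + 4 * A₃ * W₇ + A₄ * W₀ + 2 * A₅ * W₁ + 2 * A₆ * W₂ + 2 * A₆ * W₃ + 2 * A₇ * W₂ + 4 * A₇ * W₃ ∧
      (0 : 𝓞 ↥(IntermediateField.adjoin ℚ ({β} : Set (AlgebraicClosure ℚ)))) = A₀ * W₅ + A₁ * W₄ + A₂ * W₆ + 2 * A₂ * W₇ + 2 * A₃ * W₆ + 2 * A₃ * W₇ + A₄ * W₁ + A₅ * W₀ + A₆ * W₂ + 2 * A₆ * W₃ + 2 * A₇ * W₂ + 2 * A₇ * W₃ ∧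
      (0 : 𝓞 ↥(IntermediateField.adjoin ℚ ({β} : Set (AlgebraicClosure ℚ)))) = A₀ * W₆ + 2 * A₁ * W₇ + A₂ * W₄ + 2 * A₃ * W₅ + A₄ * W₂ + 2 * A₅ * W₃ + A₆ * W₀ + 2 * A₇ * W₁ ∧
      (0 : 𝓞 ↥(IntermediateField.adjoin ℚ ({β} : Set (AlgebraicClosure ℚ)))) = A₀ * W₇ + A₁ * W₆ + A₂ * W₅ + A₃ * W₄ + A₄ * W₃ + A₅ * W₂ + A₆ * W₁ + A₇ * W₀)
    (hbez : (μ₀ * A₀ + 2 * μ₁ * A₁ + 2 * μ₂ * A₂ + 2 * μ₂ * A₃ + 2 * μ₃ * A₂ + 4 * μ₃ * A₃ + 2 * μ₄ * A₄ + 2 * μ₄ * A₆ + 2 * μ₄ * A₇ + 4 * μ₅ * A₅ + 2 * μ₅ * A₆ + 4 * μ₅ * A₇ + 2 * μ₆ * A₄ + 2 * μ₆ * A₅ + 4 * μ₆ * A₆ + 4 * μ₆ * A₇ + 2 * μ₇ * A₄ + 4 * μ₇ * A₅ + 4 * μ₇ * A₆ + 8 * μ₇ * A₇) + (ν₀ *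 W₀ + 2 * ν₁ * W₁ + 2 * ν₂ * W₂ + 2 * ν₂ * W₃ + 2 * ν₃ * W₂ + 4 * ν₃ * W₃ + 2 * ν₄ * W₄ + 2 * ν₄ * W₆ + 2 * ν₄ * W₇ + 4 * ν₅ * W₅ + 2 * ν₅ * W₆ + 4 * ν₅ * W₇ + 2 * ν₆ * W₄ + 2 * ν₆ * W₅ + 4 * ν₆ * W₆ + 4 * ν₆ * W₇ + 2 * ν₇ * W₄ + 4 * ν₇ * W₅ + 4 * ν₇ * W₆ + 8 * ν₇ * W₇) = 1 ∧
      (μ₀ * A₁ + μ₁ * A₀ + μ₂ * A₂ + 2 * μ₂ * A₃ + 2 * μ₃ * A₂ + 2 * μ₃ * A₃ + 2 * μ₄ * A₅ + μ₄ * A₆ + 2 * μ₄ * A₇ + 2 * μ₅ * A₄ + 2 * μ₅ * A₆ + 2 * μ₅ * A₇ + μ₆ * A₄ + 2 * μ₆ * A₅ + 2 * μ₆ * A₆ + 4 * μ₆ * A₇ + 2 * μ₇ * A₄ + 2 * μ₇ * A₅ + 4 * μ₇ * A₆ + 4 * μ₇ * A₇) + (ν₀ * W₁ + ν₁ * W₀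 + ν₂ * W₂ + 2 * ν₂ * W₃ + 2 * ν₃ * W₂ + 2 * ν₃ * W₃ + 2 * ν₄ * W₅ + ν₄ * W₆ + 2 * ν₄ * W₇ + 2 * ν₅ * W₄ + 2 * ν₅ * W₆ + 2 * ν₅ * W₇ + ν₆ * W₄ + 2 * ν₆ * W₅ + 2 * ν₆ * W₆ + 4 * ν₆ * W₇ + 2 * ν₇ * W₄ + 2 * ν₇ * W₅ + 4 * ν₇ * W₆ + 4 * ν₇ * W₇) = 0 ∧
      (μ₀ * A₂ + 2 * μ₁ * A₃ + μ₂ * A₀ + 2 * μ₃ * A₁ + μ₄ * A₄ + 2 * μ₄ * A₆ + 2 * μ₅ * A₅ + 4 * μ₅ * A₇ + 2 * μ₆ * A₄ + 2 * μ₆ * A₆ + 2 * μ₆ * A₇ + 4 * μ₇ * A₅ + 2 * μ₇ * A₆ + 4 * μ₇ * A₇) + (ν₀ * W₂ + 2 * ν₁ * W₃ + ν₂ * W₀ + 2 * ν₃ * W₁ + ν₄ * W₄ + 2 * ν₄ * W₆ + 2 * ν₅ * W₅ + 4 * ν₅ * W₇ + 2 * ν₆ * W₄ + 2 * ν₆ *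 W₆ + 2 * ν₆ * W₇ + 4 * ν₇ * W₅ + 2 * ν₇ * W₆ + 4 * ν₇ * W₇) = 0 ∧
      (μ₀ * A₃ + μ₁ * A₂ + μ₂ * A₁ + μ₃ * A₀ + μ₄ * A₅ + 2 * μ₄ * A₇ + μ₅ * A₄ + 2 * μ₅ * A₆ + 2 * μ₆ * A₅ + μ₆ * A₆ + 2 * μ₆ * A₇ + 2 * μ₇ * A₄ + 2 * μ₇ * A₆ + 2 * μ₇ * A₇) + (ν₀ * W₃ + ν₁ * W₂ + ν₂ * W₁ + ν₃ * W₀ + ν₄ * W₅ + 2 * ν₄ * W₇ + ν₅ * W₄ + 2 * ν₅ * W₆ + 2 * ν₆ * W₅ + ν₆ * W₆ + 2 * ν₆ * W₇ + 2 * ν₇ * W₄ + 2 * ν₇ * W₆ + 2 * ν₇ * W₇) = 0 ∧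
      (μ₀ * A₄ + 2 * μ₁ * A₅ + 2 * μ₂ * A₆ + 2 * μ₂ * A₇ + 2 * μ₃ * A₆ + 4 * μ₃ * A₇ + μ₄ * A₀ + 2 * μ₅ * A₁ + 2 * μ₆ * A₂ + 2 * μ₆ * A₃ + 2 * μ₇ * A₂ + 4 * μ₇ * A₃) + (ν₀ * W₄ + 2 * ν₁ * W₅ + 2 * ν₂ * W₆ + 2 * ν₂ * W₇ + 2 * ν₃ * W₆ + 4 * ν₃ * W₇ + ν₄ * W₀ + 2 * ν₅ * W₁ + 2 * ν₆ * W₂ + 2 * ν₆ * W₃ + 2 * ν₇ * W₂ + 4 * ν₇ * W₃) = 0 ∧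
      (μ₀ * A₅ + μ₁ * A₄ + μ₂ * A₆ + 2 * μ₂ * A₇ + 2 * μ₃ * A₆ + 2 * μ₃ * A₇ + μ₄ * A₁ + μ₅ * A₀ + μ₆ * A₂ + 2 * μ₆ * A₃ + 2 * μ₇ * A₂ + 2 * μ₇ * A₃) + (ν₀ * W₅ + ν₁ * W₄ + ν₂ * W₆ + 2 * ν₂ * W₇ + 2 * ν₃ * W₆ + 2 * ν₃ * W₇ + ν₄ * W₁ + ν₅ * W₀ + ν₆ * W₂ + 2 * ν₆ * W₃ + 2 * ν₇ * W₂ + 2 * ν₇ * W₃) = 0 ∧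
      (μ₀ * A₆ + 2 * μ₁ * A₇ + μ₂ * A₄ + 2 * μ₃ * A₅ + μ₄ * A₂ + 2 * μ₅ * A₃ + μ₆ * A₀ + 2 * μ₇ * A₁) + (ν₀ * W₆ + 2 * ν₁ * W₇ + ν₂ * W₄ + 2 * ν₃ * W₅ + ν₄ * W₂ + 2 * ν₅ * W₃ + ν₆ * W₀ + 2 * ν₇ * W₁) = 0 ∧
      (μ₀ * A₇ + μ₁ * A₆ + μ₂ * A₅ + μ₃ * A₄ + μ₄ * A₃ + μ₅ * A₂ + μ₆ * A₁ + μ₇ * A₀) + (ν₀ * W₇ + ν₁ * W₆ + ν₂ * W₅ + ν₃ * W₄ + ν₄ * W₃ + ν₅ * W₂ + ν₆ * W₁ + ν₇ * W₀) = 0)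
    (hq₀ : q₀ ≠ 0)
    (hM2 : q₀ * v₀ = (α₀ * A₀ + 2 * α₁ * A₁ + 2 * α₂ * A₂ + 2 * α₂ * A₃ + 2 * α₃ * A₂ + 4 * α₃ * A₃ + 2 * α₄ * A₄ + 2 * α₄ * A₆ + 2 * α₄ * A₇ + 4 * α₅ * A₅ + 2 * α₅ * A₆ + 4 * α₅ * A₇ + 2 * α₆ * A₄ + 2 * α₆ * A₅ + 4 * α₆ * A₆ + 4 * α₆ * A₇ + 2 * α₇ * A₄ + 4 * α₇ * A₅ + 4 * α₇ * A₆ + 8 * α₇ * A₇) + β₀ * q₀ ^ 2 ∧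
      q₀ * v₁ = (α₀ * A₁ + α₁ * A₀ + α₂ * A₂ + 2 * α₂ * A₃ + 2 * α₃ * A₂ + 2 * α₃ * A₃ + 2 * α₄ * A₅ + α₄ * A₆ + 2 * α₄ * A₇ + 2 * α₅ * A₄ + 2 * α₅ * A₆ + 2 * α₅ * A₇ + α₆ * A₄ + 2 * α₆ * A₅ + 2 * α₆ * A₆ + 4 * α₆ * A₇ + 2 * α₇ * A₄ + 2 * α₇ * A₅ + 4 * α₇ * A₆ + 4 * α₇ * A₇) + β₁ * q₀ ^ 2 ∧
      q₀ * v₂ = (α₀ * A₂ + 2 * α₁ * A₃ + α₂ * A₀ + 2 * α₃ * A₁ + α₄ * A₄ + 2 * α₄ * A₆ + 2 * α₅ * A₅ + 4 * α₅ * A₇ + 2 * α₆ * A₄ + 2 * α₆ * A₆ + 2 * α₆ * A₇ + 4 * α₇ * A₅ + 2 * α₇ * A₆ + 4 * α₇ * A₇) + β₂ * q₀ ^ 2 ∧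
      q₀ * v₃ = (α₀ * A₃ + α₁ * A₂ + α₂ * A₁ + α₃ * A₀ + α₄ * A₅ + 2 * α₄ * A₇ + α₅ * A₄ + 2 * α₅ * A₆ + 2 * α₆ * A₅ + α₆ * A₆ + 2 * α₆ * A₇ + 2 * α₇ * A₄ + 2 * α₇ * A₆ + 2 * α₇ * A₇) + β₃ * q₀ ^ 2 ∧
      q₀ * v₄ = (α₀ * A₄ + 2 * α₁ * A₅ + 2 * α₂ * A₆ + 2 * α₂ * A₇ + 2 * α₃ * A₆ + 4 * α₃ * A₇ + α₄ * A₀ + 2 * α₅ * A₁ + 2 * α₆ * A₂ + 2 * α₆ * A₃ + 2 * α₇ * A₂ + 4 * α₇ * A₃) + β₄ * q₀ ^ 2 ∧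
      q₀ * v₅ = (α₀ * A₅ + α₁ * A₄ + α₂ * A₆ + 2 * α₂ * A₇ + 2 * α₃ * A₆ + 2 * α₃ * A₇ + α₄ * A₁ + α₅ * A₀ + α₆ * A₂ + 2 * α₆ * A₃ + 2 * α₇ * A₂ + 2 * α₇ * A₃) + β₅ * q₀ ^ 2 ∧
      q₀ * v₆ = (α₀ * A₆ + 2 * α₁ * A₇ + α₂ * A₄ + 2 * α₃ * A₅ + α₄ * A₂ + 2 * α₅ * A₃ + α₆ * A₀ + 2 * α₇ * A₁) + β₆ * q₀ ^ 2 ∧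
      q₀ * v₇ = (α₀ * A₇ + α₁ * A₆ + α₂ * A₅ + α₃ * A₄ + α₄ * A₃ + α₅ * A₂ + α₆ * A₁ + α₇ * A₀) + β₇ * q₀ ^ 2)
    (hV : v₀ * v₀ + 2 * v₁ * v₁ + 2 * v₂ * v₂ + 2 * v₂ * v₃ + 2 * v₃ * v₂ + 4 * v₃ * v₃ + 2 * v₄ * v₄ + 2 * v₄ * v₆ + 2 * v₄ * v₇ + 4 * v₅ * v₅ + 2 * v₅ * v₆ + 4 * v₅ * v₇ + 2 * v₆ * v₄ + 2 * v₆ * v₅ + 4 * v₆ * v₆ + 4 * v₆ * v₇ + 2 * v₇ * v₄ + 4 * v₇ * v₅ + 4 * v₇ * v₆ + 8 * v₇ * v₇ = V₀ ∧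
      v₀ * v₁ + v₁ * v₀ + v₂ * v₂ + 2 * v₂ * v₃ + 2 * v₃ * v₂ + 2 * v₃ * v₃ + 2 * v₄ * v₅ + v₄ * v₆ + 2 * v₄ * v₇ + 2 * v₅ * v₄ + 2 * v₅ * v₆ + 2 * v₅ * v₇ + v₆ * v₄ + 2 * v₆ * v₅ + 2 * v₆ * v₆ + 4 * v₆ * v₇ + 2 * v₇ * v₄ + 2 * v₇ * v₅ + 4 * v₇ * v₆ + 4 * v₇ * v₇ = V₁ ∧
      v₀ * v₂ + 2 * v₁ * v₃ + v₂ * v₀ + 2 * v₃ * v₁ + v₄ * v₄ + 2 * v₄ * v₆ + 2 * v₅ * v₅ + 4 * v₅ * v₇ + 2 * v₆ * v₄ + 2 * v₆ * v₆ + 2 * v₆ * v₇ + 4 * v₇ * v₅ + 2 * v₇ * v₆ + 4 * v₇ * v₇ = V₂ ∧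
      v₀ * v₃ + v₁ * v₂ + v₂ * v₁ + v₃ * v₀ + v₄ * v₅ + 2 * v₄ * v₇ + v₅ * v₄ + 2 * v₅ * v₆ + 2 * v₆ * v₅ + v₆ * v₆ + 2 * v₆ * v₇ + 2 * v₇ * v₄ + 2 * v₇ * v₆ + 2 * v₇ * v₇ = V₃ ∧
      v₀ * v₄ + 2 * v₁ * v₅ + 2 * v₂ * v₆ + 2 * v₂ * v₇ + 2 * v₃ * v₆ + 4 * v₃ * v₇ + v₄ * v₀ + 2 * v₅ * v₁ + 2 * v₆ * v₂ + 2 * v₆ * v₃ + 2 * v₇ * v₂ + 4 * v₇ * v₃ = V₄ ∧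
      v₀ * v₅ + v₁ * v₄ + v₂ * v₆ + 2 * v₂ * v₇ + 2 * v₃ * v₆ + 2 * v₃ * v₇ + v₄ * v₁ + v₅ * v₀ + v₆ * v₂ + 2 * v₆ * v₃ + 2 * v₇ * v₂ + 2 * v₇ * v₃ = V₅ ∧
      v₀ * v₆ + 2 * v₁ * v₇ + v₂ * v₄ + 2 * v₃ * v₅ + v₄ * v₂ + 2 * v₅ * v₃ + v₆ * v₀ + 2 * v₇ * v₁ = V₆ ∧
      v₀ * v₇ + v₁ * v₆ + v₂ * v₅ + v₃ * v₄ + v₄ * v₃ + v₅ * v₂ + v₆ * v₁ + v₇ * v₀ = V₇)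
    (hM3 : V₀ = (γ₀ * A₀ + 2 * γ₁ * A₁ + 2 * γ₂ * A₂ + 2 * γ₂ * A₃ + 2 * γ₃ * A₂ + 4 * γ₃ * A₃ + 2 * γ₄ * A₄ + 2 * γ₄ * A₆ + 2 * γ₄ * A₇ + 4 * γ₅ * A₅ + 2 * γ₅ * A₆ + 4 * γ₅ * A₇ + 2 * γ₆ * A₄ + 2 * γ₆ * A₅ + 4 * γ₆ * A₆ + 4 * γ₆ * A₇ + 2 * γ₇ * A₄ + 4 * γ₇ * A₅ + 4 * γ₇ * A₆ + 8 * γ₇ * A₇) + δ₀ * q₀ ^ 2 ∧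
      V₁ = (γ₀ * A₁ + γ₁ * A₀ + γ₂ * A₂ + 2 * γ₂ * A₃ + 2 * γ₃ * A₂ + 2 * γ₃ * A₃ + 2 * γ₄ * A₅ + γ₄ * A₆ + 2 * γ₄ * A₇ + 2 * γ₅ * A₄ + 2 * γ₅ * A₆ + 2 * γ₅ * A₇ + γ₆ * A₄ + 2 * γ₆ * A₅ + 2 * γ₆ * A₆ + 4 * γ₆ * A₇ + 2 * γ₇ * A₄ + 2 * γ₇ * A₅ + 4 * γ₇ * A₆ + 4 * γ₇ * A₇) + δ₁ * q₀ ^ 2 ∧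
      V₂ = (γ₀ * A₂ + 2 * γ₁ * A₃ + γ₂ * A₀ + 2 * γ₃ * A₁ + γ₄ * A₄ + 2 * γ₄ * A₆ + 2 * γ₅ * A₅ + 4 * γ₅ * A₇ + 2 * γ₆ * A₄ + 2 * γ₆ * A₆ + 2 * γ₆ * A₇ + 4 * γ₇ * A₅ + 2 * γ₇ * A₆ + 4 * γ₇ * A₇) + δ₂ * q₀ ^ 2 ∧
      V₃ = (γ₀ * A₃ + γ₁ * A₂ + γ₂ * A₁ + γ₃ * A₀ + γ₄ * A₅ + 2 * γ₄ * A₇ + γ₅ * A₄ + 2 * γ₅ * A₆ + 2 * γ₆ * A₅ + γ₆ * A₆ + 2 * γ₆ * A₇ + 2 * γ₇ * A₄ + 2 * γ₇ * A₆ + 2 * γ₇ * A₇) + δ₃ * q₀ ^ 2 ∧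
      V₄ = (γ₀ * A₄ + 2 * γ₁ * A₅ + 2 * γ₂ * A₆ + 2 * γ₂ * A₇ + 2 * γ₃ * A₆ + 4 * γ₃ * A₇ + γ₄ * A₀ + 2 * γ₅ * A₁ + 2 * γ₆ * A₂ + 2 * γ₆ * A₃ + 2 * γ₇ * A₂ + 4 * γ₇ * A₃) + δ₄ * q₀ ^ 2 ∧
      V₅ = (γ₀ * A₅ + γ₁ * A₄ + γ₂ * A₆ + 2 * γ₂ * A₇ + 2 * γ₃ * A₆ + 2 * γ₃ * A₇ + γ₄ * A₁ + γ₅ * A₀ + γ₆ * A₂ + 2 * γ₆ * A₃ + 2 * γ₇ * A₂ + 2 * γ₇ * A₃) + δ₅ * q₀ ^ 2 ∧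
      V₆ = (γ₀ * A₆ + 2 * γ₁ * A₇ + γ₂ * A₄ + 2 * γ₃ * A₅ + γ₄ * A₂ + 2 * γ₅ * A₃ + γ₆ * A₀ + 2 * γ₇ * A₁) + δ₆ * q₀ ^ 2 ∧
      V₇ = (γ₀ * A₇ + γ₁ * A₆ + γ₂ * A₅ + γ₃ * A₄ + γ₄ * A₃ + γ₅ * A₂ + γ₆ * A₁ + γ₇ * A₀) + δ₇ * q₀ ^ 2)
    (hM4 : A₀ = m₀ * q₀ ^ 2 + (n₀ * (q₀ * v₀) + 2 * n₁ * (q₀ * v₁) + 2 * n₂ * (q₀ * v₂) + 2 * n₂ * (q₀ * v₃) + 2 * n₃ * (q₀ * v₂) + 4 * n₃ * (q₀ * v₃) + 2 * n₄ * (q₀ * v₄) + 2 * n₄ * (q₀ * v₆) + 2 * n₄ * (q₀ * v₇) + 4 * n₅ * (q₀ * v₅) + 2 * n₅ * (q₀ * v₆) + 4 * n₅ * (q₀ * v₇) + 2 * n₆ * (q₀ * v₄) + 2 * n₆ * (q₀ * v₅) + 4 * n₆ * (q₀ * v₆) + 4 * n₆ * (q₀ * v₇) + 2 * n₇ * (q₀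 * v₄) + 4 * n₇ * (q₀ * v₅) + 4 * n₇ * (q₀ * v₆) + 8 * n₇ * (q₀ * v₇)) + (l₀ * V₀ + 2 * l₁ * V₁ + 2 * l₂ * V₂ + 2 * l₂ * V₃ + 2 * l₃ * V₂ + 4 * l₃ * V₃ + 2 * l₄ * V₄ + 2 * l₄ * V₆ + 2 * l₄ * V₇ + 4 * l₅ * V₅ + 2 * l₅ * V₆ + 4 * l₅ * V₇ + 2 * l₆ * V₄ + 2 * l₆ * V₅ + 4 * l₆ * V₆ + 4 * l₆ * V₇ + 2 * l₇ * V₄ + 4 * l₇ * V₅ + 4 * l₇ * V₆ + 8 * l₇ * V₇) ∧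
      A₁ = m₁ * q₀ ^ 2 + (n₀ * (q₀ * v₁) + n₁ * (q₀ * v₀) + n₂ * (q₀ * v₂) + 2 * n₂ * (q₀ * v₃) + 2 * n₃ * (q₀ * v₂) + 2 * n₃ * (q₀ * v₃) + 2 * n₄ * (q₀ * v₅) + n₄ * (q₀ * v₆) + 2 * n₄ * (q₀ * v₇) + 2 * n₅ * (q₀ * v₄) + 2 * n₅ * (q₀ * v₆) + 2 * n₅ * (q₀ * v₇) + n₆ * (q₀ * v₄) + 2 * n₆ * (q₀ * v₅) + 2 * n₆ * (q₀ * v₆) + 4 * n₆ * (q₀ * v₇) + 2 * n₇ * (q₀ * v₄) + 2 * n₇ * (q₀ * v₅) + 4 * n₇ * (q₀ * v₆) + 4 * n₇ * (q₀ * v₇)) + (l₀ * V₁ + l₁ * V₀ + l₂ * V₂ + 2 * l₂ * V₃ + 2 * l₃ * V₂ + 2 * l₃ * V₃ + 2 * l₄ * V₅ + l₄ * V₆ + 2 * l₄ * V₇ + 2 * l₅ * V₄ + 2 * l₅ * V₆ + 2 * l₅ * V₇ + l₆ * V₄ + 2 * l₆ * V₅ + 2 * l₆ * V₆ + 4 *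 l₆ * V₇ + 2 * l₇ * V₄ + 2 * l₇ * V₅ + 4 * l₇ * V₆ + 4 * l₇ * V₇) ∧
      A₂ = m₂ * q₀ ^ 2 + (n₀ * (q₀ * v₂) + 2 * n₁ * (q₀ * v₃) + n₂ * (q₀ * v₀) + 2 * n₃ * (q₀ * v₁) + n₄ * (q₀ * v₄) + 2 * n₄ * (q₀ * v₆) + 2 * n₅ * (q₀ * v₅) + 4 * n₅ * (q₀ * v₇) + 2 * n₆ * (q₀ * v₄) + 2 * n₆ * (q₀ * v₆) + 2 * n₆ * (q₀ * v₇) + 4 * n₇ * (q₀ * v₅) + 2 * n₇ * (q₀ * v₆) + 4 * n₇ * (q₀ * v₇)) + (l₀ * V₂ + 2 * l₁ * V₃ + l₂ * V₀ + 2 * l₃ * V₁ + l₄ * V₄ + 2 * l₄ * V₆ + 2 * l₅ * V₅ + 4 * l₅ * V₇ + 2 * l₆ * V₄ + 2 * l₆ * V₆ + 2 * l₆ * V₇ + 4 * l₇ * V₅ + 2 * l₇ * V₆ + 4 * l₇ * V₇) ∧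
      A₃ = m₃ * q₀ ^ 2 + (n₀ * (q₀ * v₃) + n₁ * (q₀ * v₂) + n₂ * (q₀ * v₁) + n₃ * (q₀ * v₀) + n₄ * (q₀ * v₅) + 2 * n₄ * (q₀ * v₇) + n₅ * (q₀ * v₄) + 2 * n₅ * (q₀ * v₆) + 2 * n₆ * (q₀ * v₅) + n₆ * (q₀ * v₆) + 2 * n₆ * (q₀ * v₇) + 2 * n₇ * (q₀ * v₄) + 2 * n₇ * (q₀ * v₆) + 2 * n₇ * (q₀ * v₇)) + (l₀ * V₃ + l₁ * V₂ + l₂ * V₁ + l₃ * V₀ + l₄ * V₅ + 2 * l₄ * V₇ + l₅ * V₄ + 2 * l₅ * V₆ + 2 * l₆ * V₅ + l₆ * V₆ + 2 * l₆ * V₇ + 2 * l₇ * V₄ + 2 * l₇ * V₆ + 2 * l₇ * V₇) ∧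
      A₄ = m₄ * q₀ ^ 2 + (n₀ * (q₀ * v₄) + 2 * n₁ * (q₀ * v₅) + 2 * n₂ * (q₀ * v₆) + 2 * n₂ * (q₀ * v₇) + 2 * n₃ * (q₀ * v₆) + 4 * n₃ * (q₀ * v₇) + n₄ * (q₀ * v₀) + 2 * n₅ * (q₀ * v₁) + 2 * n₆ * (q₀ * v₂) + 2 * n₆ * (q₀ * v₃) + 2 * n₇ * (q₀ * v₂) + 4 * n₇ * (q₀ * v₃)) + (l₀ * V₄ + 2 * l₁ * V₅ + 2 * l₂ * V₆ + 2 * l₂ * V₇ + 2 * l₃ * V₆ + 4 * l₃ * V₇ + l₄ * V₀ + 2 * l₅ * V₁ + 2 * l₆ * V₂ + 2 * l₆ * V₃ + 2 * l₇ * V₂ + 4 * l₇ * V₃) ∧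
      A₅ = m₅ * q₀ ^ 2 + (n₀ * (q₀ * v₅) + n₁ * (q₀ * v₄) + n₂ * (q₀ * v₆) + 2 * n₂ * (q₀ * v₇) + 2 * n₃ * (q₀ * v₆) + 2 * n₃ * (q₀ * v₇) + n₄ * (q₀ * v₁) + n₅ * (q₀ * v₀) + n₆ * (q₀ * v₂) + 2 * n₆ * (q₀ * v₃) + 2 * n₇ * (q₀ * v₂) + 2 * n₇ * (q₀ * v₃)) + (l₀ * V₅ + l₁ * V₄ + l₂ * V₆ + 2 * l₂ * V₇ + 2 * l₃ * V₆ + 2 * l₃ * V₇ + l₄ * V₁ + l₅ * V₀ + l₆ * V₂ + 2 * l₆ * V₃ + 2 * l₇ * V₂ + 2 * l₇ * V₃) ∧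
      A₆ = m₆ * q₀ ^ 2 + (n₀ * (q₀ * v₆) + 2 * n₁ * (q₀ * v₇) + n₂ * (q₀ * v₄) + 2 * n₃ * (q₀ * v₅) + n₄ * (q₀ * v₂) + 2 * n₅ * (q₀ * v₃) + n₆ * (q₀ * v₀) + 2 * n₇ * (q₀ * v₁)) + (l₀ * V₆ + 2 * l₁ * V₇ + l₂ * V₄ + 2 * l₃ * V₅ + l₄ * V₂ + 2 * l₅ * V₃ + l₆ * V₀ + 2 * l₇ * V₁) ∧
      A₇ = m₇ * q₀ ^ 2 + (n₀ * (q₀ * v₇) + n₁ * (q₀ * v₆) + n₂ * (q₀ * v₅) + n₃ * (q₀ * v₄) + n₄ * (q₀ * v₃) + n₅ * (q₀ * v₂) + n₆ * (q₀ * v₁) + n₇ * (q₀ * v₀)) + (l₀ * V₇ + l₁ * V₆ + l₂ * V₅ + l₃ * V₄ + l₄ * V₃ + l₅ * V₂ + l₆ * V₁ + l₇ * V₀))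
    (hcert : ∀ (e : Fin n → ℕ) (e' : ℕ) (σ : ℤˣ), (∀ i, e i ≤ 1) → e' ≤ 1 → ¬ (e = 0 ∧ e' = 0 ∧ σ = 1) →
      ∃ (q : ℕ) (ψ : 𝓞 ↥(IntermediateField.adjoin ℚ ({β} : Set (AlgebraicClosure ℚ))) →+* ZMod q) (t r₁ r₂ r₃ : ZMod q), 2 * t = 1 ∧ r₁ ^ 2 = 2 ∧ r₂ ^ 2 = 2 + r₁ ∧ r₃ ^ 2 = 2 + r₂ ∧
        ¬ IsSquare (((σ : ℤ) : ZMod q) *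
          (∏ i, (ψ (a₀ i) + ψ (a₁ i) * r₁ + (ψ (a₂ i) + ψ (a₃ i) * r₁) * r₂ + (ψ (a₄ i) + ψ (a₅ i) * r₁ + (ψ (a₆ i) + ψ (a₇ i) * r₁) * r₂) * r₃) ^ e i) *
          (ψ A₀ + ψ A₁ * r₁ + (ψ A₂ + ψ A₃ * r₁) * r₂ + (ψ A₄ + ψ A₅ * r₁ + (ψ A₆ + ψ A₇ * r₁) * r₂) * r₃) ^ e'))
    (κP : ZpExtension ↥(IntermediateField.adjoin ℚ ({β} : Set (AlgebraicClosure ℚ))) 2) (hκP : κP.IsCyclotomic) :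
    ∃ c : ClassGroup (𝓞 (κP.layer 3)), orderOf c = 4 := by
  have hirr := AlignedTransportAtTwoSeed.irr_two_of_forall_not_hasRationalTwoTorsionX W ht
  have hβint : IsIntegral ℚ β := ((AlgebraicClosure.isAlgebraic ℚ).isAlgebraic β).isIntegral
  haveI : FiniteDimensional ℚ ↥(IntermediateField.adjoin ℚ ({β} : Set (AlgebraicClosure ℚ))) := IntermediateField.adjoin.finiteDimensional hβint
  haveI : NumberField ↥(IntermediateField.adjoin ℚ ({β} : Set (AlgebraicClosure ℚ))) := NumberField.mk
  have h3 : Module.finrank ℚ ↥(IntermediateField.adjoin ℚ ({β} : Set (AlgebraicClosure ℚ))) = 3 := AddKatoTwo.finrank_adjoin_root_twoTorsionPolynomial_eq_three W hirr hβ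
  have hodd3 : ¬ 2 ∣ Module.finrank ℚ ↥(IntermediateField.adjoin ℚ ({β} : Set (AlgebraicClosure ℚ))) := by rw [h3]; decide
  have hr1 := nrRealPlaces_adjoin_root_twoTorsionPolynomial_eq_one W hΔ hirr hβ
  have hPl : 8 * Fintype.card (InfinitePlace ↥(IntermediateField.adjoin ℚ ({β} : Set (AlgebraicClosure ℚ)))) ≤ n + 1 := by
    have h := InfinitePlace.card_add_two_mul_card_eq_rank (K := ↥(IntermediateField.adjoin ℚ ({β} : Set (AlgebraicClosure ℚ))))
    rw [h3, hr1] at h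
    rw [InfinitePlace.card_eq_nrRealPlaces_add_nrComplexPlaces, hr1]
    omega
  exact exists_orderOf_eq_four_layer_three_of_tower3Cert hodd3 hd hPl κP hκP a₀ a₁ a₂ a₃ a₄ a₅ a₆ a₇ c₀ c₁ c₂ c₃ c₄ c₅ c₆ c₇ hu hws hbez hq₀ hM2 hV hM3 hM4 hcert

end Summit.BirchSwinnertonDyer.BirchSwinnertonDyer.Theorems.AlignedTransportAtTwoCubicLayerThreeOrderFourDoor

end
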